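import Summits.AnomalousDissipation.AnomalousDissipation.Theses.TaylorCertificates
import Summits.AnomalousDissipation.AnomalousDissipation.Theorems.TaylorCertificatePair.Negative.Modes
import Literature.Analysis.FunctionSpaces.TorusFluidGlueProofs

/-!
# An explicit mean-zero trigonometric quiet Euler point (two Beltrami shells)

Crux `TaylorCertificates.SmoothEulerCoerciveForce` (stmt-AnomalousDissipation-14097), negative side
(cdisprove seat `refuter-cdisprove-stmt-AnomalousDissipation-14097-0`).  The crux asks for a smooth
divergence-free mean-zero force `f` on `T³` with NO smooth divergence-free mean-zero `v` solving the steady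
forced Euler equations weakly, `∫ ⟪(v·∇)v − f, w⟫ = 0` for all smooth divergence-free mean-zero `w`.

This file records, sorry-free and without new definitions, the simplest member of the "two Beltrami
shells" family of NON-witnesses: if `curl A = λA` and `curl B = μB` then the self-interactions of `A` and
`B` are gradients, so `v = A + B` is a quiet point of the explicit force `P[(v·∇)v] = P[(A·∇)B + (B·∇)A]`.
Concretely (unit torus, `X = 2πx₁`, `Z = 2πx₃`), with real modes `Re(e_k(x) • z) = Torus.realTrigPoly {k} z`:

* quiet point `v₀ = (sin Z, cos Z − sin X, cos X) = Re(e_{(0,0,1)} • (−i,1,0)) + Re(e_{(1,0,0)} • (0,i,1))`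
  (curl-eigenvalues `+2π` and `−2π`), written `∑ mm, Torus.realTrigPoly {K mm} (fun _ => Zp mm)` with
  `K = ![![0,0,1], ![1,0,0]]`, `Zp = ![(−i,1,0), (0,i,1)]`;
* force `f₀ = −4π cos X sin Z · e₂ = Re(e_{(1,0,1)} • (0,2πi,0)) + Re(e_{(−1,0,1)} • (0,2πi,0))`, written
  `∑ mm, Torus.realTrigPoly {KF mm} (fun _ => (0,2πi,0))`, `KF = ![(1,0,1), (−1,0,1)]`;
* `(v₀·∇)v₀ = f₀ + ∇(sin X cos Z)`.

Main results: `twoBeltrami_quiet` (the weak steady Euler identity against every smooth div-free `w`) and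
`twoBeltrami_not_witness`: `f₀` is smooth, divergence free, mean zero, and FAILS the `∀ v` clause of the
crux.  Proof: move the derivative onto the test field (`Torus.integral_inner_convect_eq_neg`, antisymmetry of
the trilinear form), evaluate the inertial pairing of the mode sum in Fourier variables
(`Negative.inertial_modes`, the landed pair formula of the sibling crux `TaylorCertificatePair`), and close
with the transversality `k · ŵ(k) = 0` of the test field's coefficients at `k = (1,0,1), (−1,0,1)` and their
conjugate symmetry.  No statement of the route is asserted positively (the crux is `∃ f`; this excludes one
explicit family of candidate witnesses, in particular every two-variable Kolmogorov-type shear force).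
-/

noncomputable section

open MeasureTheory UnitAddTorus Matrix
open scoped InnerProductSpace ComplexConjugate

namespace Summit.AnomalousDissipation.AnomalousDissipation.Theorems.SmoothEulerCoerciveForce.Negative

open Literature.Analysis.FunctionSpaces
open Summit.AnomalousDissipation.AnomalousDissipation.Theorems.TaylorCertificatePair.Negative

/-- **The weak steady Euler identity** `∫ ⟪(v₀·∇)v₀ − f₀, w⟫ = 0` for every smooth divergence-free test field
`w`, with `v₀ = ∑ₘ Re(e_{K m} • Zp m) = (sin Z, cos Z − sin X, cos X)` and `f₀ = ∑ₘ Re(e_{KF m} • y) = −4π cos X sin Z · e₂`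
(the data are passed as variables pinned by equations, to keep the literals out of the rewriting). -/
theorem twoBeltrami_quiet {K KF : Fin 2 → Fin 3 → ℤ} {Zp : Fin 2 → EuclideanSpace ℂ (Fin 3)}
    {y : EuclideanSpace ℂ (Fin 3)} (hK : K = ![![0, 0, 1], ![1, 0, 0]])
    (hZp : Zp = ![WithLp.toLp 2 ![-Complex.I, 1, 0], WithLp.toLp 2 ![0, Complex.I, 1]])
    (hKF : KF = ![![1, 0, 1], ![-1, 0, 1]]) (hy : y = WithLp.toLp 2 ![0, 2 * Real.pi * Complex.I, 0])
    (w : UnitAddTorus (Fin 3) → EuclideanSpace ℝ (Fin 3)) (hws : Torus.IsSmooth w) (hwd : Torus.IsDivFree w) :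
    ∫ x, ⟪Torus.convect (∑ mm, Torus.realTrigPoly {K mm} (fun _ => Zp mm))
        (∑ mm, Torus.realTrigPoly {K mm} (fun _ => Zp mm)) x -
        (∑ mm, Torus.realTrigPoly {KF mm} (fun _ => y)) x, w x⟫_ℝ = 0 := by
  have hZp' : ∀ m, ((fun j => ((K m) j : ℂ)) ⬝ᵥ (WithLp.ofLp (Zp m))) = 0 := by
    intro m; fin_cases m <;> simp [hK, hZp, dotProduct, Fin.sum_univ_three]
  have hvs : Torus.IsSmooth (∑ mm, Torus.realTrigPoly {K mm} (fun _ => Zp mm)) := isSmooth_modes K Zp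
  have hvd : Torus.IsDivFree (∑ mm, Torus.realTrigPoly {K mm} (fun _ => Zp mm)) := isDivFree_modes K Zp hZp'
  have hfs : Torus.IsSmooth (∑ mm, Torus.realTrigPoly {KF mm} (fun _ => y)) := isSmooth_modes KF (fun _ => y)
  have hwi : Integrable w volume := hws.integrable
  -- split the integrand
  have h1 : Integrable (fun x => ⟪Torus.convect (∑ mm, Torus.realTrigPoly {K mm} (fun _ => Zp mm))
      (∑ mm, Torus.realTrigPoly {K mm} (fun _ => Zp mm)) x, w x⟫_ℝ) volume :=
    ((hvs.convect hvs).inner hws).integrable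
  have h2 : Integrable (fun x => ⟪(∑ mm, Torus.realTrigPoly {KF mm} (fun _ => y)) x, w x⟫_ℝ) volume :=
    (hfs.inner hws).integrable
  simp_rw [inner_sub_left]
  rw [integral_sub h1 h2]
  -- move the derivative onto `w` (antisymmetry of the trilinear form) and use the pair formula
  rw [Torus.integral_inner_convect_eq_neg hvs hvd hvs hws]
  have hcomm : ∫ x, ⟪(∑ mm, Torus.realTrigPoly {K mm} (fun _ => Zp mm)) x,
        Torus.convect (∑ mm, Torus.realTrigPoly {K mm} (fun _ => Zp mm)) w x⟫_ℝ =
      ∫ x, ⟪Torus.fderiv w x ((∑ mm, Torus.realTrigPoly {K mm} (fun _ => Zp mm)) x),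
        (∑ mm, Torus.realTrigPoly {K mm} (fun _ => Zp mm)) x⟫_ℝ :=
    integral_congr_ae (ae_of_all _ fun x => real_inner_comm _ _)
  rw [hcomm, inertial_modes hws]
  -- the force pairing
  have hf : ∫ x, ⟪(∑ mm, Torus.realTrigPoly {KF mm} (fun _ => y)) x, w x⟫_ℝ =
      ∑ m, (⟪y, mFourierCoeff (EuclideanSpace.complexify ∘ w) (KF m)⟫_ℂ).re := by
    simp_rw [modes_apply, sum_inner]
    rw [integral_finsetSum _ fun m _ =>
      ((continuous_mode _ _).inner hws.continuous).integrable_unitAddTorus]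
    exact Finset.sum_congr rfl fun m _ => integral_inner_mode_left hwi _ _
  rw [hf]
  -- Fourier-side facts about `w`: conjugate symmetry and transversality of its coefficients
  have e1 : K 0 + K 1 = KF 0 := by
    funext i; fin_cases i <;> simp [hK, hKF]
  have e2 : K 1 + K 0 = KF 0 := by
    funext i; fin_cases i <;> simp [hK, hKF]
  have e3 : K 0 - K 1 = KF 1 := by
    funext i; fin_cases i <;> simp [hK, hKF]
  have e4 : K 1 - K 0 = -KF 1 := by
    funext i; fin_cases i <;> simp [hK, hKF]
  have hcs : mFourierCoeff (EuclideanSpace.complexify ∘ w) (-KF 1) =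
      EuclideanSpace.conjVec (mFourierCoeff (EuclideanSpace.complexify ∘ w) (KF 1)) :=
    Torus.isConjSymm_mFourierCoeff hwi (KF 1)
  have htp := hwd.sum_mul_mFourierCoeff_eq_zero hws (KF 0)
  have htm := hwd.sum_mul_mFourierCoeff_eq_zero hws (KF 1)
  simp only [Fin.sum_univ_two]
  rw [e1, e2, e3, e4, hcs]
  set A := mFourierCoeff (EuclideanSpace.complexify ∘ w) (KF 0) with hA
  set B := mFourierCoeff (EuclideanSpace.complexify ∘ w) (KF 1) with hB
  clear_value A B
  subst hK hZp hKF hy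
  simp only [Fin.sum_univ_three, Matrix.cons_val_zero, Matrix.cons_val_one, Matrix.head_cons,
    Matrix.cons_val_two, Matrix.tail_cons] at htp htm
  simp only [dotProduct, Fin.sum_univ_three, Pi.add_apply, Pi.sub_apply, Pi.neg_apply,
    Matrix.cons_val_zero, Matrix.cons_val_one, Matrix.head_cons, Matrix.cons_val_two, Matrix.tail_cons,
    PiLp.inner_apply, RCLike.inner_apply, EuclideanSpace.conjVec_apply]
  simp only [Int.cast_add, Int.cast_sub, Int.cast_neg, Int.cast_zero, Int.cast_one] at htp htm ⊢
  have hA2 : A 2 = -A 0 := by linear_combination htp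
  have hB2 : B 2 = B 0 := by linear_combination htm
  simp only [hA2, hB2, map_neg, Complex.conj_conj]
  simp [Complex.mul_re, Complex.mul_im, Complex.conj_re, Complex.conj_im]
  ring

/-- **`f₀ = −4π cos X sin Z · e₂` is not a witness of `SmoothEulerCoerciveForce`.** The force (as a real mode
sum) is smooth, divergence free and mean zero — the three hypotheses the crux puts on `f` — and the `∀ v` clause
of the crux FAILS for it: `v₀ = (sin Z, cos Z − sin X, cos X)` is a smooth, divergence-free, MEAN-ZERO (no
Galilean drift) quiet Euler point.  Informative negative lemma; the crux (`∃ f`) is not refuted by it. -/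
theorem twoBeltrami_not_witness :
    Torus.IsSmooth (∑ mm, Torus.realTrigPoly {(![![1, 0, 1], ![-1, 0, 1]] : Fin 2 → Fin 3 → ℤ) mm}
          (fun _ => (WithLp.toLp 2 ![0, 2 * Real.pi * Complex.I, 0] : EuclideanSpace ℂ (Fin 3)))) ∧
    Torus.IsDivFree (∑ mm, Torus.realTrigPoly {(![![1, 0, 1], ![-1, 0, 1]] : Fin 2 → Fin 3 → ℤ) mm}
          (fun _ => (WithLp.toLp 2 ![0, 2 * Real.pi * Complex.I, 0] : EuclideanSpace ℂ (Fin 3)))) ∧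
    Torus.HasZeroMean (∑ mm, Torus.realTrigPoly {(![![1, 0, 1], ![-1, 0, 1]] : Fin 2 → Fin 3 → ℤ) mm}
          (fun _ => (WithLp.toLp 2 ![0, 2 * Real.pi * Complex.I, 0] : EuclideanSpace ℂ (Fin 3)))) ∧
    ¬ (∀ v : UnitAddTorus (Fin 3) → EuclideanSpace ℝ (Fin 3), Torus.IsSmooth v → Torus.IsDivFree v →
          Torus.HasZeroMean v →
          (∀ w : UnitAddTorus (Fin 3) → EuclideanSpace ℝ (Fin 3), Torus.IsSmooth w → Torus.IsDivFree w →
            Torus.HasZeroMean w →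
            ∫ x, ⟪Torus.convect v v x -
              (∑ mm, Torus.realTrigPoly {(![![1, 0, 1], ![-1, 0, 1]] : Fin 2 → Fin 3 → ℤ) mm}
                (fun _ => (WithLp.toLp 2 ![0, 2 * Real.pi * Complex.I, 0] : EuclideanSpace ℂ (Fin 3)))) x,
              w x⟫_ℝ = 0) → False) := by
  have hKF0 : ∀ m, (![![1, 0, 1], ![-1, 0, 1]] : Fin 2 → Fin 3 → ℤ) m ≠ 0 := by
    intro m h
    fin_cases m
    · have := congrFun h 2; simp at this
    · have := congrFun h 2; simp at this
  have hK0 : ∀ m, (![![0, 0, 1], ![1, 0, 0]] : Fin 2 → Fin 3 → ℤ) m ≠ 0 := by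
    intro m h
    fin_cases m
    · have := congrFun h 2; simp at this
    · have := congrFun h 0; simp at this
  have hy' : ∀ m, ((fun j => (((![![1, 0, 1], ![-1, 0, 1]] : Fin 2 → Fin 3 → ℤ) m) j : ℂ)) ⬝ᵥ
      (WithLp.ofLp (WithLp.toLp 2 ![0, 2 * Real.pi * Complex.I, 0] : EuclideanSpace ℂ (Fin 3)))) = 0 := by
    intro m; fin_cases m <;> simp [dotProduct, Fin.sum_univ_three]
  have hZp' : ∀ m, ((fun j => (((![![0, 0, 1], ![1, 0, 0]] : Fin 2 → Fin 3 → ℤ) m) j : ℂ)) ⬝ᵥ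
      (WithLp.ofLp ((![WithLp.toLp 2 ![-Complex.I, 1, 0], WithLp.toLp 2 ![0, Complex.I, 1]] :
        Fin 2 → EuclideanSpace ℂ (Fin 3)) m))) = 0 := by
    intro m; fin_cases m <;> simp [dotProduct, Fin.sum_univ_three]
  refine ⟨isSmooth_modes _ _, isDivFree_modes _ _ hy', hasZeroMean_modes _ _ hKF0, fun h => ?_⟩
  exact h _ (isSmooth_modes _ _) (isDivFree_modes _ _ hZp') (hasZeroMean_modes _ _ hK0)
    fun w hws hwd _ => twoBeltrami_quiet rfl rfl rfl rfl w hws hwd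

end Summit.AnomalousDissipation.AnomalousDissipation.Theorems.SmoothEulerCoerciveForce.Negative
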